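import Summits.CriticalPhenomena.CardyFormulaZ2.Theses.CardyDualCurrent
import Literature.Probability.RandomPlanarGeometry.SLEExistenceNeEightHolds
import HarnessLib

/-!
# `SLE6CurveExists` — chordal SLE₆ random curves exist in every Dobrushin domain

Route `CardyDualCurrent`, support item stmt-CriticalPhenomena-7295.

The item asks for `∀ D : DobrushinDomain, ∃ Γ, IsSLECurve 6 D Γ`. This is exactly the
Literature theorem `Literature.Probability.RandomPlanarGeometry.exists_isSLECurve_six`
(`SLEExistenceNeEightHolds.lean`), which is unconditional in the tree: Rohde–Schramm (2005)
Thm. 5.1 (`hasSLETrace_of_ne_eight_apply`, generation by a curve for `κ ≠ 8`) and Thm. 7.1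
(`tendsto_norm_sleTrace_atTop_of_ne_eight`, a.s. transience) fed into `exists_isSLECurve_at`
(Riemann mapping, Carathéodory boundary extension, measurability of the trace — all proved).

## References

* S. Rohde, O. Schramm, *Basic properties of SLE*, Ann. of Math. 161 (2005), Thm. 5.1, Thm. 7.1.
-/

namespace Summit.CriticalPhenomena.CardyFormulaZ2.Theorems

/-- **Chordal SLE₆ exists as a random curve in every Dobrushin domain** — the route item
`SLE6CurveExists` of `CardyDualCurrent`, discharged by the Literature theorem
`exists_isSLECurve_six` (Rohde–Schramm 2005, Thm. 5.1 + Thm. 7.1 at `κ = 6 ≠ 8`). -/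
theorem SLE6CurveExists_proof :
    Summit.CriticalPhenomena.CardyFormulaZ2.Theses.CardyDualCurrent.SLE6CurveExists := by
  unfold Summit.CriticalPhenomena.CardyFormulaZ2.Theses.CardyDualCurrent.SLE6CurveExists
  intro D
  exact Literature.Probability.RandomPlanarGeometry.exists_isSLECurve_six D

end Summit.CriticalPhenomena.CardyFormulaZ2.Theorems
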